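/-
Copyright (c) 2026 the pub-hodgecm-mathlib formalisation cell (harness21).  Prover seat hodgecm-mathlib-K2E3-p06 (g2), Track B «K2-LIT» ∕ h413,
ENGINE E3 unit U4 «Keys», SIGS-TABLE row #6 `sig_K2E3IrregularReducibleCaseThree` — analytic letter hKP, brick F3b (the limit `T → ∞` of the fibred zeta integrals).
-/
import Summits.HodgeConjecture.HodgeConjecture.Theorems.K2E3SkewLineZetaFibration   -- ★ brick F3 (this seat): the fibration `x = s(1+η)`; brings ★ F2
import HarnessLib

/-!
# K2 · E3 · U4 «Keys», row #6 — brick F3b: as `T_k → ∞`, `∫_E Φ(Re x) 𝟙[‖Im x‖ ≤ T_k] χ̃(x) ‖x‖⁻¹ dx → (∫_{E⁺} Φ χ̃ (√‖·‖)⁻¹ dμ⁺) · ∫_{E⁻} ‖1+η‖⁻¹ χ̃(1+η) dμ⁻`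
# [Keys1984 §5; Tate1950 §2.4; WeilBNT1967 VII §2]

Cell `pub/hodgecm-mathlib` (D-0151), HCML Track B «K2-LIT», crux H413 = `stmt-HodgeConjecture-24833` (lane `--supports … --as helper`), route
HCCMUnconditional; socket `sig_K2E3IrregularReducibleCaseThree` (U4-c) of `Cruxes/H413/Lines/K2_E3_EllipticInputsSigs_U4Keys.lean`.
THEOREMS ONLY (0 def ∕ 0 instance ∕ 0 notation ∕ 0 sorry); ★-only imports.  FRAME and hypotheses as in ★ brick F3 (`E` a non-archimedean local field with a
continuous isometric involution `σ`, `2 ∈ Eˣ`, regular Haar measures `μ^±` of `E^±`, `μ_E = (μ⁺ ⊗ μ⁻) ∘ ringDecomp⁻¹`; `Φ` bounded measurable vanishing near `0` and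
off a ball, `D` bounded measurable multiplicative, a `σ`-skew unit `δ`).
* **`tendsto_integral_truncTest_mul`** — `∫_E Φ(½(x+σx)) 𝟙[‖½(x−σx)‖ ≤ T_k] D(x) ‖x‖⁻¹ dμ_E → (∫_{E⁺} Φ D (√‖·‖)⁻¹ dμ⁺) · ∫_{E⁻} ‖1+η‖⁻¹ • D(1+η) dμ⁻` for `T_k → ∞`:
  ★ F3 writes each term as `∫_{E⁺}` of the fibre integrals, which at a.e. `s` equal `Φ(s)D(s)(√‖s‖)⁻¹ · J_D(T_k/‖s‖)` (★ `integral_fibre_truncTest_mul`), are dominated by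
  `C_Φ C (√ε)⁻¹ ‖J_D‖_{L¹} 𝟙[‖s‖ ≤ R]` and converge by ★ F2 `tendsto_integral_indicator_skewBall`; dominated convergence over `E⁺`.
This is the «`J = 0 ⇒ Z(g_T, χ, 0) → 0`» half of the proof of hKP by Tate's Fubini trick at `s = 0` (bricks F1–F5).
HONEST LABEL: HC_CM is proved only modulo the 7 printed citations (2 remaining named inputs: hLiu418 = `stmt-HodgeConjecture-24832`, h413 =
`stmt-HodgeConjecture-24833`) until rung 0 closes; count-neutral analytic plumbing (no socket paid here).

## References
* [Keys1984] D. Keys, *Principal series representations of special unitary groups over local fields*, Compositio Math. 51 (1984), §5.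
* [Tate1950] J. Tate, *Fourier analysis in number fields and Hecke's zeta-functions* (1950), §2.2, §2.4.
* [WeilBNT1967] A. Weil, *Basic Number Theory* (1967), Ch. I §2, Ch. VII §2.
-/

set_option autoImplicit false
-- the mandated namespace has the single-problem summit's repeated segment (`HodgeConjecture.HodgeConjecture`)
set_option linter.dupNamespace false

noncomputable section

open scoped NNReal ENNReal Topology Pointwise
open MeasureTheory Filter Set
open Literature.NumberTheory.GaloisRepresentations.IsNonarchimedeanLocalField
open Literature.NumberTheory.Automorphic
open Literature.NumberTheory.Automorphic.UnitaryGroup.HeisRing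
open Summit.HodgeConjecture.HodgeConjecture.Cruxes.H413.K2E3SkewLineIntegrable
open Summit.HodgeConjecture.HodgeConjecture.Cruxes.H413.K2E3SkewLineZetaFibration

namespace Summit.HodgeConjecture.HodgeConjecture.Cruxes.H413.K2E3SkewLineZetaLimit

variable {E : Type*} [Field E] [ValuativeRel E] [TopologicalSpace E] [IsNonarchimedeanLocalField E]
  (σ : E →+* E) (hσ : ∀ x, σ (σ x) = x) (hσc : Continuous σ) [Invertible (2 : E)]
  (hσn : ∀ x, normAbs E (σ x) = normAbs E x)

/-! ## The limit `T → ∞` -/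

section Limit

variable [MeasurableSpace E] [BorelSpace E] [T2Space E] [SecondCountableTopology E]
  (μp : Measure (fixedPart σ)) [μp.IsAddHaarMeasure] [μp.Regular] (μm : Measure (skewPart σ)) [μm.IsAddHaarMeasure] [μm.Regular]

include hσ hσn in
/-- **`Z(g_{T_k}, χ, 0) → (∫_{E⁺} Φ D (√‖·‖)⁻¹ dμ⁺) · J_D` as `T_k → ∞`**, `J_D = ∫_{E⁻} ‖1+η‖⁻¹ • D(1+η) dμ⁻`: dominated convergence over `E⁺` (the fibre integrals are bounded by
`‖Φ(s) D(s)‖ (√‖s‖)⁻¹ · ‖J_D‖_{L¹}` on `{ε ≤ ‖s‖ ≤ R}`) and ★ F2 `tendsto_integral_indicator_skewBall` in each fibre. [cite: Keys1984, §5] [cite: Tate1950, §2.4] -/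
theorem tendsto_integral_truncTest_mul (δ : Eˣ) (hδ : σ (δ : E) = -δ)
    (Φ : E → ℂ) (hΦm : Measurable Φ) {CΦ : ℝ} (hΦb : ∀ a, ‖Φ a‖ ≤ CΦ) {ε : ℝ≥0} (hε : 0 < ε) (hΦ0 : ∀ a, normAbs E a < ε → Φ a = 0)
    {R : ℝ≥0} (hΦR : ∀ a, R < normAbs E a → Φ a = 0)
    (D : E → ℂ) (hDm : Measurable D) {C : ℝ} (hDb : ∀ b, ‖D b‖ ≤ C) (hD : ∀ a b, D (a * b) = D a * D b)
    (T : ℕ → ℝ≥0) (hT : Tendsto T atTop atTop) :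
    Tendsto (fun k => ∫ x, Φ (⅟(2 : E) * (x + σ x)) * ({y : E | normAbs E y ≤ T k}.indicator (fun _ => (1 : ℂ)) (⅟(2 : E) * (x - σ x))) *
        (D x * ((((normAbs E x : ℝ≥0) : ℝ) : ℂ))⁻¹) ∂((μp.prod μm).map (ringDecomp σ hσ hσc).symm)) atTop
      (𝓝 ((∫ s : fixedPart σ, Φ (s : E) * D (s : E) * ((((NNReal.sqrt (normAbs E (s : E)))⁻¹ : ℝ≥0) : ℝ) : ℂ) ∂μp) *
        ∫ η : skewPart σ, (((normAbs E (1 + (η : E)))⁻¹ : ℝ≥0)) • D (1 + (η : E)) ∂μm)) := by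
  haveI := locallyCompactSpace_fixedPart σ hσc
  haveI := locallyCompactSpace_skewPart σ hσc
  haveI : SecondCountableTopology (fixedPart σ) := TopologicalSpace.Subtype.secondCountableTopology _
  haveI : SecondCountableTopology (skewPart σ) := TopologicalSpace.Subtype.secondCountableTopology _
  have hC : 0 ≤ C := le_trans (norm_nonneg _) (hDb 0)
  have hCΦ : 0 ≤ CΦ := le_trans (norm_nonneg _) (hΦb 0)
  -- notation
  set F : skewPart σ → ℂ := fun η => (((normAbs E (1 + (η : E)))⁻¹ : ℝ≥0)) • D (1 + (η : E)) with hFdef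
  set c : fixedPart σ → ℂ := fun s => Φ (s : E) * D (s : E) * ((((NNReal.sqrt (normAbs E (s : E)))⁻¹ : ℝ≥0) : ℝ) : ℂ) with hcdef
  have hFint : Integrable F μm := integrable_inv_normAbs_smul_skewPart σ hσ hσc hσn μm δ hδ D hDm hDb
  -- rewrite every term as an iterated integral, and the limit as `∫ c · J`
  have hk : ∀ k, ∫ x, Φ (⅟(2 : E) * (x + σ x)) * ({y : E | normAbs E y ≤ T k}.indicator (fun _ => (1 : ℂ)) (⅟(2 : E) * (x - σ x))) *
        (D x * ((((normAbs E x : ℝ≥0) : ℝ) : ℂ))⁻¹) ∂((μp.prod μm).map (ringDecomp σ hσ hσc).symm) =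
      ∫ s : fixedPart σ, ∫ y : skewPart σ, Φ (⅟(2 : E) * (((s : E) + (y : E)) + σ ((s : E) + (y : E)))) *
        ({y : E | normAbs E y ≤ T k}.indicator (fun _ => (1 : ℂ)) (⅟(2 : E) * (((s : E) + (y : E)) - σ ((s : E) + (y : E))))) *
        (D ((s : E) + (y : E)) * ((((normAbs E ((s : E) + (y : E)) : ℝ≥0) : ℝ) : ℂ))⁻¹) ∂μm ∂μp :=
    fun k => integral_truncTest_mul_eq_integral_integral σ hσ hσc hσn μp μm Φ hΦm hΦb hε hΦ0 hΦR D hDm hDb (T k)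
  simp_rw [hk]
  rw [← integral_mul_const]
  -- dominated convergence over `E⁺`
  set bound : fixedPart σ → ℝ := {s : fixedPart σ | normAbs E (s : E) ≤ R}.indicator
    (fun _ => CΦ * C * (((NNReal.sqrt ε)⁻¹ : ℝ≥0) : ℝ) * ∫ η, ‖F η‖ ∂μm) with hbdef
  have hnp : Continuous fun s : fixedPart σ => normAbs E (s : E) := LocalFieldHaar.continuous_normAbs.comp continuous_subtype_val
  have hRm : MeasurableSet {s : fixedPart σ | normAbs E (s : E) ≤ R} := measurableSet_le hnp.measurable measurable_const
  have hRfin : μp {s : fixedPart σ | normAbs E (s : E) ≤ R} < ⊤ :=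
    ((isClosed_fixedPart σ hσc).isClosedEmbedding_subtypeVal.isCompact_preimage (isCompact_setOf_normAbs_le R)).measure_lt_top
  have hbint : Integrable bound μp := by
    rw [hbdef, integrable_indicator_iff hRm]
    exact Measure.integrableOn_of_bounded hRfin.ne aestronglyMeasurable_const (Eventually.of_forall fun _ => le_rfl)
  -- the pointwise bound `‖c s‖ ≤ …` and the a.e. identification of the fibre integrals
  have hcb : ∀ s : fixedPart σ, ‖c s‖ ≤ {s : fixedPart σ | normAbs E (s : E) ≤ R}.indicator (fun _ => CΦ * C * (((NNReal.sqrt ε)⁻¹ : ℝ≥0) : ℝ)) s := by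
    intro s
    by_cases hΦs : Φ (s : E) = 0
    · rw [hcdef]; dsimp only; rw [hΦs, zero_mul, zero_mul, norm_zero]
      exact Set.indicator_nonneg (fun _ _ => by positivity) _
    · have hεs : ε ≤ normAbs E (s : E) := by by_contra h; push Not at h; exact hΦs (hΦ0 _ h)
      have hRs : normAbs E (s : E) ≤ R := by by_contra h; push Not at h; exact hΦs (hΦR _ h)
      rw [Set.indicator_of_mem (show s ∈ {s : fixedPart σ | normAbs E (s : E) ≤ R} from hRs)]
      have hd : ((((NNReal.sqrt (normAbs E (s : E)))⁻¹ : ℝ≥0) : ℝ)) ≤ (((NNReal.sqrt ε)⁻¹ : ℝ≥0) : ℝ) := by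
        rw [NNReal.coe_le_coe]; exact inv_anti₀ (NNReal.sqrt_pos.2 hε) (NNReal.sqrt_le_sqrt.2 hεs)
      rw [hcdef]; dsimp only
      rw [norm_mul, norm_mul, Complex.norm_real, Real.norm_of_nonneg (NNReal.coe_nonneg _)]
      gcongr
      · exact hΦb _
      · exact hDb _
  refine tendsto_integral_filter_of_dominated_convergence bound ?_ ?_ hbint ?_
  · -- measurability of the fibre integrals: Fubini
    exact Eventually.of_forall fun k =>
      (integrable_truncTest_mul_prod σ hσc hσn μp μm Φ hΦm hΦb hε hΦ0 hΦR D hDm hDb (T k)).integral_prod_left.aestronglyMeasurable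
  · -- the bound, a.e. (at the units `s`)
    refine Eventually.of_forall fun k => ?_
    filter_upwards [ae_ne_zero_fixedPart σ hσ hσc hσn δ hδ μp] with s hs
    rw [integral_fibre_truncTest_mul σ hσ hσc μm δ hδ Φ D hD (T k) s hs, norm_mul]
    calc ‖c s‖ * ‖∫ η, ({η : skewPart σ | normAbs E (η : E) ≤ T k / normAbs E (s : E)}.indicator F) η ∂μm‖
        ≤ {s : fixedPart σ | normAbs E (s : E) ≤ R}.indicator (fun _ => CΦ * C * (((NNReal.sqrt ε)⁻¹ : ℝ≥0) : ℝ)) s * ∫ η, ‖F η‖ ∂μm :=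
          mul_le_mul (hcb s) (norm_integral_indicator_le σ μm hFint _) (norm_nonneg _) (Set.indicator_nonneg (fun _ _ => by positivity) _)
      _ = bound s := by
          rw [hbdef]
          by_cases h : s ∈ {s : fixedPart σ | normAbs E (s : E) ≤ R}
          · rw [Set.indicator_of_mem h, Set.indicator_of_mem h]
          · rw [Set.indicator_of_notMem h, Set.indicator_of_notMem h, zero_mul]
  · -- the pointwise limit, a.e.
    filter_upwards [ae_ne_zero_fixedPart σ hσ hσc hσn δ hδ μp] with s hs
    have hev : (fun k => ∫ y : skewPart σ, Φ (⅟(2 : E) * (((s : E) + (y : E)) + σ ((s : E) + (y : E)))) *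
        ({y : E | normAbs E y ≤ T k}.indicator (fun _ => (1 : ℂ)) (⅟(2 : E) * (((s : E) + (y : E)) - σ ((s : E) + (y : E))))) *
        (D ((s : E) + (y : E)) * ((((normAbs E ((s : E) + (y : E)) : ℝ≥0) : ℝ) : ℂ))⁻¹) ∂μm) =
        fun k => c s * ∫ η, ({η : skewPart σ | normAbs E (η : E) ≤ T k / normAbs E (s : E)}.indicator F) η ∂μm := by
      funext k; exact integral_fibre_truncTest_mul σ hσ hσc μm δ hδ Φ D hD (T k) s hs
    rw [hev]
    refine Tendsto.const_mul (c s) ?_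
    have hns : 0 < normAbs E (s : E) := pos_iff_ne_zero.2 ((map_ne_zero _).2 hs)
    have hT' : Tendsto (fun k => T k / normAbs E (s : E)) atTop atTop := hT.atTop_div_const hns
    exact tendsto_integral_indicator_skewBall σ hσ hσc hσn μm δ hδ D hDm hDb _ hT'

end Limit

end Summit.HodgeConjecture.HodgeConjecture.Cruxes.H413.K2E3SkewLineZetaLimit

end
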